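import Summits.BirchSwinnertonDyer.BirchSwinnertonDyer.Theorems.EisensteinPrimesAnomalousTowerTorsionFinite
import Summits.BirchSwinnertonDyer.BirchSwinnertonDyer.Theorems.EisensteinPrimesRamifiedCharNoLocalFixed
import Summits.BirchSwinnertonDyer.BirchSwinnertonDyer.Theorems.EisensteinPrimesCharResidualSelmerKummer
import Summits.BirchSwinnertonDyer.Rank1Residual.X2.ResidualDevissageModules
import Literature.NumberTheory.EllipticCurves.SelmerCorankAssembly
import Literature.NumberTheory.EllipticCurves.PointDivisibilityProofs
import HarnessLib

/-!
# Route `EisensteinPrimes`, crux 2 `GoodLatticeBDPValue` (stmt-BirchSwinnertonDyer-19032), line `halves` v20, stub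
# `stub_indexInputs`: **the global and local `H⁰` conjuncts and the curve-side Kummer conjuncts**, by name, on the crux
# binders and for EVERY `Γ_K`-stable line `Φ ≤ E_K[p]` with its Teichmüller embeddings

Cell `bsd-eis` (home `run/shared/lean/pub/bsd-eis/`), width seat `bsd-line-x1-p1-w6` («width 6»; `--supports -19032`,
closes nothing). The LEAD's v20 skeleton (`Cruxes/GoodLatticeBDPValue/Lines/halves.lean`) replaces the PRE stub
`stub_imprimLambda` (Keller–Yin Thm. 1.4.1 (iii)) by the V21 INDEX ROAD: the landed mid-level composition
`ResidualIndexAssembly.zpCorank_datumStrictSelmer_add_eq` fed by ONE existential package `stub_indexInputs` of inputs in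
`H¹`/`H⁰`-language. This file proves, as separate by-name theorems universally quantified over the line data (any
`Φ : StableSubgroup Γ_K E_K[p]` with `#Φ.Sub = p`, any equivariant embedding `j : Φ.Quot ↪ (F/𝒪)(θ)` of a Teichmüller
character), the following conjuncts of that package (names as destructured in the skeleton's `imprimLambdaT_of_index`):

* `hN₁D`  `sub_eq_zero_of_fixed_kerSubgroup_inf_decomp` — `Φ.Sub` has no non-zero `ker κ ⊓ D_v̄`-fixed vector
  (the line is moved by `I_v̄`, `AnomalousLocalTorsion.exists_mem_inertia_smul_ne`, and `p`-power descent
  `eq_zero_of_mem_line_of_fixed`; KY: «`H⁰(K_{∞,w}, 𝔽(ω)) = 0`», TeX L1043).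
* `hN₂`   `torsion_eq_zero_of_fixed_kerSubgroup` — `E_K[p]^{ker κ} = 0` from `E(K)[p] = 0` (`E_K[p]^{ker κ} = E_K[p]^{Γ_K}`
  by `smul_eq_of_fixed_of_natCard_eq_sq` with `D = Γ_K`, then Galois descent `exists_toGeomPoints_eq_of_forall_smul_eq`).
* `hinv₂` `exists_fixed_nsmul_eq_primaryTorsion_kerSubgroup` — hence `E_K[p^∞]^{ker κ} = 0`, trivially divisible in invariants.
* `hinv₁ hinv₃ hinvD₁ hinvD₃` `exists_fixed_nsmul_eq_charModule_subgroup` — `(F/𝒪)(θ)^{G'}` is `p`-divisible in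
  invariants for EVERY `G' ≤ Γ_K` (w4 gen 3's `charModule_invariants_divisible`, instantiated at a subgroup action).
* `hfinq hε` `finite_fixed_quot_kerSubgroup`, **`natCard_fixed_quot_kerSubgroup`** — `#(Φ.Quot)^{ker κ} = p^ε`,
  `ε = [θquot = 1]`: Teichmüller rigidity + `p`-power descent from `Γ_K` to `ker κ`
  (`exists_mem_inf_kerSubgroup_unitChar_ne_one` with `D = Γ_K`; KY: «`H⁰(K_Σ/K_∞, 𝔽(𝟙̃)) = 𝔽^{[𝟙̃ = 𝟙]}`»).
* `hfinQ`  `finite_quot` — `Φ.Quot` finite (order `p`).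
* `hfinED` — NOT here: landed meanwhile by width seat w7 (`AnomalousLocalTorsion.finite_fixed_geomPrimaryTorsion_inf_decomp`,
  p648505), as was a second proof of `htrivD`/`hN₁D` (this seat's p648414 `…IndexInputsAnomalousQuotient` has the first).
* `hr₂ hd₂` `mem_range_inclusion_iff_nsmul_eq_zero`, `exists_nsmul_eq_primaryTorsion` — `E_K[p] = E_K[p^∞][p]` and
  `E_K[p^∞]` is `p`-divisible (`zsmul_geomPoints_surjective_holds`, Silverman III.4.2 (a)).

Not here (other seats / files): `htrivD` (this seat's `…IndexInputsAnomalousQuotient`), SUR ×3 (w3), `H²` (w4/w2), (U), COT.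

HONEST FRAMING: helper theorems only (0 definitions, 0 named facts, 0 sorry); no summit statement, no BSD / IMC2 / KY
Thm 1.4.1 (iii) is proved; 0 stubs / cells / labels move. References: [KellerYin2024] §1.3 (Lemma 1.2.4, Prop. 1.3.3,
Lemma 1.3.5), §1.4 Cases I–III (arXiv:2402.12781v2 TeX L766–772, L922–960, L1043, L1142–1330); [GreenbergLNM1716] §4 p. 109;
[SilvermanAEC2009] III.4.2 (a), VIII.§1.
-/

set_option autoImplicit false
-- the route's Theorems namespace repeats the summit name by design (D-0017 nested layout)
set_option linter.dupNamespace false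

noncomputable section

open scoped Classical Pointwise

namespace Summit.BirchSwinnertonDyer.BirchSwinnertonDyer.Theorems.IndexInputsH0

open NumberField IsDedekindDomain Field WeierstrassCurve
  Literature.NumberTheory.EllipticCurves Literature.NumberTheory.EllipticCurves.GreenbergSelmer
  Literature.NumberTheory.EllipticCurves.Rank1Residual Literature.NumberTheory.GaloisRepresentations
  Literature.NumberTheory.EllipticCurves.KellerYin2024
  Summit.BirchSwinnertonDyer.Rank1Residual.X2.ResidualDevissageModules
  Summit.BirchSwinnertonDyer.BirchSwinnertonDyer.Theorems.AnomalousLocalTorsion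

variable (W : WeierstrassCurve ℚ) [W.IsElliptic] [W.IsGloballyMinimal] {p : ℕ} [hp : Fact p.Prime]
  {K : Type} [Field K] [NumberField K] (κ : ZpExtension K p)

/-! ## §1. A stable line of `E_K[p]` read in `E_K(K̄)` -/

omit [W.IsElliptic] [W.IsGloballyMinimal] hp in
/-- The underlying subgroup of `E_K(K̄)` of a stable line `Φ ≤ E_K[p]`: contained in `E_K[p]`, of the same order,
`Γ_K`-stable, with the obvious membership criterion. [folklore] -/
theorem map_subtype_line (Φ : StableSubgroup (absoluteGaloisGroup K) ↥((W.baseChange K).geomTorsion (p : ℤ))) :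
    (Φ.toAddSubgroup.map ((W.baseChange K).geomTorsion (p : ℤ)).subtype ≤ (W.baseChange K).geomTorsion (p : ℤ)) ∧
      Nat.card (Φ.toAddSubgroup.map ((W.baseChange K).geomTorsion (p : ℤ)).subtype) = Nat.card Φ.Sub ∧
      (∀ (σ : absoluteGaloisGroup K), ∀ P ∈ Φ.toAddSubgroup.map ((W.baseChange K).geomTorsion (p : ℤ)).subtype,
        σ • P ∈ Φ.toAddSubgroup.map ((W.baseChange K).geomTorsion (p : ℤ)).subtype) ∧
      ∀ Q : ↥((W.baseChange K).geomTorsion (p : ℤ)),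
        (Q : geomPoints (W.baseChange K)) ∈ Φ.toAddSubgroup.map ((W.baseChange K).geomTorsion (p : ℤ)).subtype ↔
          Q ∈ Φ.toAddSubgroup := by
  refine ⟨?_, ?_, ?_, fun Q ↦ ?_⟩
  · rintro _ ⟨Q, -, rfl⟩; exact Q.2
  · exact Nat.card_congr (Φ.toAddSubgroup.equivMapOfInjective _ Subtype.val_injective).toEquiv.symm
  · rintro σ _ ⟨Q, hQ, rfl⟩
    exact ⟨σ • Q, Φ.smul_mem' σ hQ, by rw [AddSubgroup.coe_subtype, AddSubgroup.torsionBy.coe_smul]⟩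
  · constructor
    · rintro ⟨Q', hQ', h⟩
      have : Q' = Q := Subtype.ext h
      rw [← this]; exact hQ'
    · intro hQ; exact ⟨Q, hQ, rfl⟩

/-! ## §2. Local `H⁰` at `v̄`: `hN₁D` -/

/-- **`hN₁D`: `Φ.Sub` has no non-zero vector fixed by `ker κ ⊓ D_v̄`**, on the binders of crux 2 (`p` odd, `Anom W p`, no
unramified rational `p`-line, `K` imaginary quadratic, `p = v v̄`) for every `Γ_K`-stable line `Φ ≤ E_K[p]` and EVERY
`ℤ_p`-extension `κ`: the line is moved by `I_v̄ ≤ D_v̄` (`exists_mem_inertia_smul_ne`) hence has no non-zero point fixed by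
`D_v̄ ⊓ ker κ` (`eq_zero_of_mem_line_of_fixed`). KY: `N_ω^{G_j} = 0`. [cite: KellerYin2024, §1.3 (arXiv:2402.12781v2 TeX L1040–1046) and §1.4 Cases I–III] -/
theorem sub_eq_zero_of_fixed_kerSubgroup_inf_decomp (hp2 : p ≠ 2) (hanom : Anom W p)
    (hGL : ∀ Φ : AddSubgroup (geomTorsion W (p : ℤ)), IsRationalLine W p Φ → ¬ LineUnramifiedAt W p Φ)
    (hK : IsImaginaryQuadratic K) {v vbar : HeightOneSpectrum (𝓞 K)} (hpv : ((p : ℕ) : 𝓞 K) ∈ v.asIdeal)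
    (hpvbar : ((p : ℕ) : 𝓞 K) ∈ vbar.asIdeal) (hne : vbar ≠ v)
    (Φ : StableSubgroup (absoluteGaloisGroup K) ↥((W.baseChange K).geomTorsion (p : ℤ))) (hΦ : Nat.card Φ.Sub = p)
    (n : Φ.Sub) (hn : ∀ g : ↥(κ.kerSubgroup ⊓ GreenbergSelmer.decomp vbar), g • n = n) : n = 0 := by
  obtain ⟨hle, hcard, hstab, hmem⟩ := map_subtype_line W Φ
  rw [hΦ] at hcard
  obtain ⟨τ, hτ, P, hP, hτP⟩ := exists_mem_inertia_smul_ne W hp2 hanom hGL hK hpv hpvbar hne hle hcard hstab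
  have h0 : ((Φ.incl n : ↥((W.baseChange K).geomTorsion (p : ℤ))) : geomPoints (W.baseChange K)) = 0 := by
    refine eq_zero_of_mem_line_of_fixed κ (GreenbergSelmer.decomp vbar) (isClosed_decomp vbar)
      (continuous_smul_geomPoints (W.baseChange K)) _ hcard (GreenbergSelmer.inertia_le_decomp vbar hτ)
      (hstab τ) ⟨P, hP, hτP⟩ ((hmem _).mpr n.2) fun g hg ↦ ?_
    obtain ⟨hgD, hgk⟩ := Subgroup.mem_inf.mp hg
    have h := congrArg (fun x : Φ.Sub ↦ ((Φ.incl x : ↥((W.baseChange K).geomTorsion (p : ℤ))) :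
      geomPoints (W.baseChange K))) (hn ⟨g, Subgroup.mem_inf.mpr ⟨hgk, hgD⟩⟩)
    simp only [Subgroup.mk_smul, StableSubgroup.incl_smul, AddSubgroup.torsionBy.coe_smul] at h
    exact h
  apply Φ.incl_injective
  rw [map_zero]
  exact Subtype.ext h0

/-! ## §3. Global `H⁰`: `hN₂`, `hinv₂` -/

/-- **`hN₂`: `E_K[p]^{ker κ} = 0` when `E(K)[p] = 0`**, on the binders of crux 2 and for EVERY `ℤ_p`-extension `κ`: a point of
`E_K[p]` fixed by `ker κ` is fixed by all of `Γ_K` (`smul_eq_of_fixed_of_natCard_eq_sq` with `D = Γ_K`, `#E_K[p] = p²`, the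
stable line moved by inertia), hence `K`-rational (`exists_toGeomPoints_eq_of_forall_smul_eq`), hence `0`. KY: `N_f^G =
E(K_∞)[p] = 0`. [cite: KellerYin2024, §1.4 (arXiv:2402.12781v2 TeX L1178–1200)] [cite: GreenbergLNM1716, §4 proof of Prop. 4.8 (p. 109)] -/
theorem torsion_eq_zero_of_fixed_kerSubgroup (hp2 : p ≠ 2) (hanom : Anom W p)
    (hGL : ∀ Φ : AddSubgroup (geomTorsion W (p : ℤ)), IsRationalLine W p Φ → ¬ LineUnramifiedAt W p Φ)
    (hK : IsImaginaryQuadratic K) {v vbar : HeightOneSpectrum (𝓞 K)} (hpv : ((p : ℕ) : 𝓞 K) ∈ v.asIdeal)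
    (hpvbar : ((p : ℕ) : 𝓞 K) ∈ vbar.asIdeal) (hne : vbar ≠ v)
    (htor : ∀ Q : (W.baseChange K).toAffine.Point, p • Q = 0 → Q = 0)
    (n : ↥((W.baseChange K).geomTorsion (p : ℤ))) (hn : ∀ g : ↥κ.kerSubgroup, g • n = n) : n = 0 := by
  have hpr : p.Prime := hp.out
  haveI hEK : (W.baseChange K).IsElliptic := inferInstanceAs (W.map (algebraMap ℚ K)).IsElliptic
  obtain ⟨L, hLle, hL, hLstab⟩ := exists_stable_line_baseChange W (K := K) hanom.1
  obtain ⟨τ, hτ, P, hP, hτP⟩ := exists_mem_inertia_smul_ne W hp2 hanom hGL hK hpv hpvbar hne hLle hL hLstab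
  -- fixed by all of `Γ_K`
  have hall : ∀ d ∈ (⊤ : Subgroup (absoluteGaloisGroup K)), d • (n : geomPoints (W.baseChange K)) = n :=
    smul_eq_of_fixed_of_natCard_eq_sq κ ⊤ isClosed_univ (continuous_smul_geomPoints (W.baseChange K)) L
      ((W.baseChange K).geomTorsion (p : ℤ)) hLle hL ((W.baseChange K).natCard_geomTorsion_prime_eq_sq hpr)
      (fun d _ m hm ↦ by
        have := ((d • ⟨m, hm⟩ : ↥((W.baseChange K).geomTorsion (p : ℤ)))).2
        rwa [AddSubgroup.torsionBy.coe_smul] at this)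
      (Subgroup.mem_top τ) (hLstab τ) ⟨P, hP, hτP⟩ n.2 fun g hg ↦ by
        have h := congrArg (fun x : ↥((W.baseChange K).geomTorsion (p : ℤ)) ↦ (x : geomPoints (W.baseChange K)))
          (hn ⟨g, (Subgroup.mem_inf.mp hg).2⟩)
        simp only [Subgroup.mk_smul, AddSubgroup.torsionBy.coe_smul] at h
        exact h
  -- descend to `E(K)`
  obtain ⟨Q, hQ⟩ := (W.baseChange K).exists_toGeomPoints_eq_of_forall_smul_eq (Q := (n : geomPoints (W.baseChange K)))
    fun g ↦ hall g (Subgroup.mem_top g)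
  have hQp : p • Q = 0 := by
    apply WeierstrassCurve.toGeomPoints_injective (W.baseChange K)
    rw [map_nsmul, hQ, map_zero, ← natCast_zsmul]
    exact (Submodule.mem_torsionBy_iff _ _).mp n.2
  have hQ0 : Q = 0 := htor Q hQp
  apply Subtype.ext
  rw [← hQ, hQ0, map_zero]
  rfl

/-- **`E_K[p^∞]^{ker κ} = 0`** (same hypotheses): a non-zero `p`-primary point fixed by `ker κ` has a multiple of order `p` fixed by
`ker κ`. [cite: KellerYin2024, §1.4 (arXiv:2402.12781v2 TeX L1178–1200)] -/
theorem primaryTorsion_eq_zero_of_fixed_kerSubgroup (hp2 : p ≠ 2) (hanom : Anom W p)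
    (hGL : ∀ Φ : AddSubgroup (geomTorsion W (p : ℤ)), IsRationalLine W p Φ → ¬ LineUnramifiedAt W p Φ)
    (hK : IsImaginaryQuadratic K) {v vbar : HeightOneSpectrum (𝓞 K)} (hpv : ((p : ℕ) : 𝓞 K) ∈ v.asIdeal)
    (hpvbar : ((p : ℕ) : 𝓞 K) ∈ vbar.asIdeal) (hne : vbar ≠ v)
    (htor : ∀ Q : (W.baseChange K).toAffine.Point, p • Q = 0 → Q = 0)
    (x : ↥((W.baseChange K).geomPrimaryTorsion p)) (hx : ∀ g : ↥κ.kerSubgroup, g • x = x) : x = 0 := by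
  have hpr : p.Prime := hp.out
  by_contra hx0
  -- the order of `x` is `p^(k+1)`; `y = p^k • x` has order `p` and is fixed
  obtain ⟨m, hm⟩ := x.2
  have hx0' : (x : geomPoints (W.baseChange K)) ≠ 0 := fun h ↦ hx0 (Subtype.ext h)
  classical
  -- minimal `m` with `p^m • x = 0`
  have hex : ∃ m : ℕ, p ^ m • (x : geomPoints (W.baseChange K)) = 0 := ⟨m, hm⟩
  set m₀ := Nat.find hex with hm₀
  have hm₀spec : p ^ m₀ • (x : geomPoints (W.baseChange K)) = 0 := Nat.find_spec hex
  have hm₀pos : m₀ ≠ 0 := by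
    intro h
    rw [h, pow_zero, one_smul] at hm₀spec
    exact hx0' hm₀spec
  obtain ⟨k, hk⟩ := Nat.exists_eq_add_one_of_ne_zero hm₀pos
  have hyne : p ^ k • (x : geomPoints (W.baseChange K)) ≠ 0 := by
    have := Nat.find_min hex (m := k) (by rw [← hm₀, hk]; exact Nat.lt_succ_self k)
    exact this
  have hyp : (p : ℤ) • (p ^ k • (x : geomPoints (W.baseChange K))) = 0 := by
    rw [natCast_zsmul, ← mul_smul, ← pow_succ', ← hk]; exact hm₀spec
  set y : ↥((W.baseChange K).geomTorsion (p : ℤ)) := ⟨p ^ k • (x : geomPoints (W.baseChange K)),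
    (Submodule.mem_torsionBy_iff _ _).mpr hyp⟩ with hy
  have hyfix : ∀ g : ↥κ.kerSubgroup, g • y = y := fun g ↦ by
    apply Subtype.ext
    rw [AddSubgroup.torsionBy.coe_smul, Subgroup.mk_smul, smul_comm, ← primaryComponent.coe_smul,
      ← Subgroup.mk_smul g.1 g.2, hx g]
  have := torsion_eq_zero_of_fixed_kerSubgroup W κ hp2 hanom hGL hK hpv hpvbar hne htor y hyfix
  exact hyne (congrArg Subtype.val this)

/-- **`hinv₂`: `E_K[p^∞]^{ker κ}` is `p`-divisible in invariants** — trivially, being `0` (same hypotheses).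
[cite: KellerYin2024, §1.4 (arXiv:2402.12781v2 TeX L1178–1200)] -/
theorem exists_fixed_nsmul_eq_primaryTorsion_kerSubgroup (hp2 : p ≠ 2) (hanom : Anom W p)
    (hGL : ∀ Φ : AddSubgroup (geomTorsion W (p : ℤ)), IsRationalLine W p Φ → ¬ LineUnramifiedAt W p Φ)
    (hK : IsImaginaryQuadratic K) {v vbar : HeightOneSpectrum (𝓞 K)} (hpv : ((p : ℕ) : 𝓞 K) ∈ v.asIdeal)
    (hpvbar : ((p : ℕ) : 𝓞 K) ∈ vbar.asIdeal) (hne : vbar ≠ v)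
    (htor : ∀ Q : (W.baseChange K).toAffine.Point, p • Q = 0 → Q = 0)
    (x : ↥((W.baseChange K).geomPrimaryTorsion p)) (hx : ∀ g : ↥κ.kerSubgroup, g • x = x) :
    ∃ x' : ↥((W.baseChange K).geomPrimaryTorsion p), (∀ g : ↥κ.kerSubgroup, g • x' = x') ∧ p • x' = x :=
  ⟨0, fun g ↦ smul_zero g, by
    rw [primaryTorsion_eq_zero_of_fixed_kerSubgroup W κ hp2 hanom hGL hK hpv hpvbar hne htor x hx, smul_zero]⟩

/-! ## §4. Character modules: invariants divisible under any subgroup (`hinv₁ hinv₃ hinvD₁ hinvD₃`) -/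

omit [NumberField K] in
/-- **`(F/𝒪)(θ)^{G'}` is `p`-divisible in invariants for every subgroup `G' ≤ Γ_K`** and every Teichmüller character `θ`
(`θ^{p−1} = 1`): w4 gen 3's `charModule_invariants_divisible` at the subgroup action. Instances: `G' = ker κ` (`hinv₁`,
`hinv₃`), `G' = ker κ ⊓ D_v̄` (`hinvD₁`, `hinvD₃`). [cite: KellerYin2024, Lemma 1.2.4 (arXiv:2402.12781v2 TeX L766–772)] -/
theorem exists_fixed_nsmul_eq_charModule_subgroup
    (θ : FramedGaloisRep K (padicCoeffIntegers (∅ : Set (PadicAlgCl p))) 1)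
    (hθ : ∀ σ : absoluteGaloisGroup K, θ σ ^ (p - 1) = 1) (G' : Subgroup (absoluteGaloisGroup K))
    (x : charModule (∅ : Set (PadicAlgCl p)) θ) (hx : ∀ g : ↥G', g • x = x) :
    ∃ x' : charModule (∅ : Set (PadicAlgCl p)) θ, (∀ g : ↥G', g • x' = x') ∧ p • x' = x :=
  CharResidualSelmerCount.charModule_invariants_divisible θ hθ (G := ↥G') (fun g ↦ (g : absoluteGaloisGroup K))
    (fun _ _ ↦ rfl) x hx

/-! ## §5. Global `H⁰` of the quotient line: `hfinq`, `hε` -/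

section Quot

variable (θ : FramedGaloisRep K (padicCoeffIntegers (∅ : Set (PadicAlgCl p))) 1)

omit [W.IsGloballyMinimal] in
/-- `#Φ.Quot = p` for a stable line of order `p` in `E_K[p]` (`#E_K[p] = p²`). [cite: SilvermanAEC2009, Cor. III.6.4 (b)] -/
theorem natCard_quot (Φ : StableSubgroup (absoluteGaloisGroup K) ↥((W.baseChange K).geomTorsion (p : ℤ)))
    (hΦ : Nat.card Φ.Sub = p) : Nat.card Φ.Quot = p := by
  haveI hEK : (W.baseChange K).IsElliptic := inferInstanceAs (W.map (algebraMap ℚ K)).IsElliptic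
  have h := Φ.natCard_eq_mul
  rw [(W.baseChange K).natCard_geomTorsion_prime_eq_sq hp.out, hΦ, sq] at h
  exact (Nat.eq_of_mul_eq_mul_right hp.out.pos h).symm

omit [W.IsGloballyMinimal] in
/-- **`hfinQ`: `Φ.Quot` is finite** (order `p`). [cite: SilvermanAEC2009, Cor. III.6.4 (b)] -/
theorem finite_quot (Φ : StableSubgroup (absoluteGaloisGroup K) ↥((W.baseChange K).geomTorsion (p : ℤ)))
    (hΦ : Nat.card Φ.Sub = p) : Finite Φ.Quot :=
  Nat.finite_of_card_ne_zero (by rw [natCard_quot W Φ hΦ]; exact hp.out.ne_zero)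

omit [W.IsGloballyMinimal] in
/-- **`hfinq`**: the `G'`-fixed part of `Φ.Quot` is finite, for any `G'`. [folklore] -/
theorem finite_fixed_quot (Φ : StableSubgroup (absoluteGaloisGroup K) ↥((W.baseChange K).geomTorsion (p : ℤ)))
    (hΦ : Nat.card Φ.Sub = p) (G' : Subgroup (absoluteGaloisGroup K)) :
    Finite {n : Φ.Quot // ∀ g : ↥G', g • n = n} := by
  haveI := finite_quot W Φ hΦ
  exact Subtype.finite

omit [NumberField K] in
/-- `unitChar θ σ = 1 → θ σ = 1` (a `1 × 1` invertible matrix is its entry). [cite: KellerYin2024, §1.1 (arXiv:2402.12781v2 TeX L441–449)] -/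
theorem apply_eq_one_of_unitChar_eq_one {σ : absoluteGaloisGroup K} (h : unitChar θ σ = 1) : θ σ = 1 := by
  have h00 := padicIntEquiv_unitChar θ σ
  rw [h, Units.val_one, map_one] at h00
  refine Units.ext (Matrix.ext fun i k ↦ ?_)
  rw [Fin.fin_one_eq_zero i, Fin.fin_one_eq_zero k, ← h00]
  simp

omit [W.IsGloballyMinimal] in
/-- **`hε`: `#(Φ.Quot)^{ker κ} = p^ε`, `ε = [θ = 1]`**, for a stable line `Φ ≤ E_K[p]` of order `p` with an equivariant
embedding `j : Φ.Quot ↪ (F/𝒪)(θ)` of a Teichmüller character `θ` (`θ^{p−1} = 1`; the residual pair's `θquot = 𝟙̃`), and ANY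
`ℤ_p`-extension `κ` of the number field `K`. If `θ = 1`, `Γ_K` acts trivially on `(F/𝒪)(θ)`, hence on `Φ.Quot`: the fixed part is
everything (`p` elements). If `θ(σ) ≠ 1` for some `σ`, `p`-power descent (`exists_mem_inf_kerSubgroup_unitChar_ne_one` with
`D = Γ_K`) gives `g ∈ ker κ` with `θ(g) ≠ 1`, which fixes no non-zero vector (`eq_zero_of_smul_eq_of_hom`): the fixed part is `0`.
KY: `N_1^G = 𝔽^{ε}`, «`H⁰(K_Σ/K_∞, 𝔽(𝟙̃))`». [cite: KellerYin2024, Lemma 1.2.4 and §1.4 (arXiv:2402.12781v2 TeX L766–772, L1178–1200)]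
[cite: GreenbergLNM1716, §4 proof of Prop. 4.8 (p. 109)] -/
theorem natCard_fixed_quot_kerSubgroup
    (Φ : StableSubgroup (absoluteGaloisGroup K) ↥((W.baseChange K).geomTorsion (p : ℤ))) (hΦ : Nat.card Φ.Sub = p)
    (hθ : ∀ σ : absoluteGaloisGroup K, θ σ ^ (p - 1) = 1)
    (j : Φ.Quot →+ charModule (∅ : Set (PadicAlgCl p)) θ)
    (hj : ∀ (σ : absoluteGaloisGroup K) (y : Φ.Quot), j (σ • y) = σ • j y) (hinj : Function.Injective j) :
    Nat.card {n : Φ.Quot // ∀ g : ↥κ.kerSubgroup, g • n = n} =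
      p ^ (if ∀ σ : absoluteGaloisGroup K, θ σ = 1 then 1 else 0) := by
  haveI := finite_quot W Φ hΦ
  by_cases hall : ∀ σ : absoluteGaloisGroup K, θ σ = 1
  · -- everything is fixed
    rw [if_pos hall, pow_one]
    refine Eq.trans ?_ (natCard_quot W Φ hΦ)
    have hfix : ∀ (σ : absoluteGaloisGroup K) (y : Φ.Quot), σ • y = y := fun σ y ↦ by
      apply hinj
      rw [hj]
      obtain ⟨z, hz⟩ := (charModuleEquiv θ).symm.surjective (j y)
      have h1 : unitChar θ σ = 1 := by
        have := unitChar_pow_eq_one θ (n := 1) (fun τ ↦ by rw [pow_one]; exact hall τ) σ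
        rwa [pow_one] at this
      rw [← hz, CharResidualSelmerFinite.galois_smul_charModuleEquiv_symm, h1, Units.val_one, one_smul]
    exact Nat.card_congr
      { toFun := fun n ↦ n.1
        invFun := fun y ↦ ⟨y, fun g ↦ by rw [Subgroup.smul_def]; exact hfix _ y⟩
        left_inv := fun n ↦ rfl
        right_inv := fun y ↦ rfl }
  · -- nothing but `0` is fixed
    rw [if_neg hall, pow_zero]
    obtain ⟨σ, hσ⟩ := not_forall.mp hall
    have hσ' : unitChar θ σ ≠ 1 := fun h ↦ hσ (apply_eq_one_of_unitChar_eq_one θ h)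
    obtain ⟨g, hg, hgne⟩ := CharResidualSelmerCount.exists_mem_inf_kerSubgroup_unitChar_ne_one κ θ hθ ⊤
      isClosed_univ (Subgroup.mem_top σ) hσ'
    have hgk : g ∈ κ.kerSubgroup := (Subgroup.mem_inf.mp hg).2
    haveI : Subsingleton {n : Φ.Quot // ∀ g : ↥κ.kerSubgroup, g • n = n} := ⟨fun a b ↦ by
      have ha : a.1 = 0 := CharResidualSelmerCount.eq_zero_of_smul_eq_of_hom θ hθ j hj hinj hgne
        (by have := a.2 ⟨g, hgk⟩; rwa [Subgroup.mk_smul] at this)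
      have hb : b.1 = 0 := CharResidualSelmerCount.eq_zero_of_smul_eq_of_hom θ hθ j hj hinj hgne
        (by have := b.2 ⟨g, hgk⟩; rwa [Subgroup.mk_smul] at this)
      exact Subtype.ext (ha.trans hb.symm)⟩
    exact Nat.card_of_subsingleton ⟨0, fun g ↦ smul_zero g⟩

end Quot

/-! ## §6. Fin_v in the subtype shape (`hfinED`)

Landed meanwhile by width seat w7 as `AnomalousLocalTorsion.finite_fixed_geomPrimaryTorsion_inf_decomp`
(`Theorems/EisensteinPrimesResidualIndexHZeroLocal.lean`, p648505) — not restated here (dedup). -/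

/-! ## §7. The curve-side Kummer conjuncts (`hr₂`, `hd₂`) -/

omit [W.IsElliptic] [W.IsGloballyMinimal] hp in
/-- **`hr₂`: `E_K[p]` is the `p`-torsion of `E_K[p^∞]`** along the inclusion. [folklore] -/
theorem mem_range_inclusion_iff_nsmul_eq_zero (x : ↥((W.baseChange K).geomPrimaryTorsion p)) :
    x ∈ (AddSubgroup.inclusion (geomTorsion_le_geomPrimaryTorsion (W.baseChange K) p)).range ↔ p • x = 0 := by
  constructor
  · rintro ⟨y, rfl⟩
    apply Subtype.ext
    rw [AddSubgroupClass.coe_nsmul, AddSubgroup.coe_inclusion, ZeroMemClass.coe_zero, ← natCast_zsmul]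
    exact (Submodule.mem_torsionBy_iff _ _).mp y.2
  · intro hx
    have hx' : (p : ℤ) • (x : geomPoints (W.baseChange K)) = 0 := by
      rw [natCast_zsmul, ← AddSubgroupClass.coe_nsmul, hx, ZeroMemClass.coe_zero]
    exact ⟨⟨(x : geomPoints (W.baseChange K)), (Submodule.mem_torsionBy_iff _ _).mpr hx'⟩, Subtype.ext rfl⟩

omit [W.IsGloballyMinimal] in
/-- **`hd₂`: `E_K[p^∞]` is `p`-divisible** (`E_K(K̄)` is divisible, Silverman III.4.2 (a): `zsmul_geomPoints_surjective_holds`).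
[cite: SilvermanAEC2009, III.4.2 (a) with II.2.3] -/
theorem exists_nsmul_eq_primaryTorsion (x : ↥((W.baseChange K).geomPrimaryTorsion p)) :
    ∃ x' : ↥((W.baseChange K).geomPrimaryTorsion p), p • x' = x := by
  haveI hEK : (W.baseChange K).IsElliptic := inferInstanceAs (W.map (algebraMap ℚ K)).IsElliptic
  exact exists_nsmul_eq_geomPrimaryTorsion (W.baseChange K) p (W.baseChange K).zsmul_geomPoints_surjective_holds x

end Summit.BirchSwinnertonDyer.BirchSwinnertonDyer.Theorems.IndexInputsH0

end
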